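import Summits.MatrixMultiplication.OmegaCensus.ThreeSetZ17Frame446
import Summits.MatrixMultiplication.OmegaCensus.ThreeSetLineInverseCertificate
import HarnessLib

/-!
# The census cell `(4,4,6)@289` (`Dih(ℤ₁₇²)`) modulo the four killer computations

ω-census `pub-omega`, family (b3), seat pub-omega-group gen 39.  Framing: lottery ticket; floor = certified bounds/negative ranges.
VALUE: the kernel route for the three-set cell `(4,4,6)@289` (hitherto ENGINE ×3, same reduction — NR74), complete except for the
finite killer tables, which enter as the hypothesis `hkill` (discharged by `ThreeSetZ17Killers446*.lean` / `…Join`, `ThreeSetZ17Cells446`);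
NOT progress on ω.

* `exists_killer_line_of_cube_form_44_card289` — W-normalisation (`W = {w₀, w₁, w₂, w₃}`, translate, frame by a pair with non-zero
  determinant, or else `W` lies in a proper coset — `card_eq_one_of_subset_coset`) + `Z17Frame446.exists_killer_line_core`.
* `no_cube_form_44_card289_of_killers` — … hence no cube symmetric form with `|W| = |X| = 4`, `|Y| = 6` over `|A| = 289`, `A ↠ ℤ₁₇²`,
  GIVEN the killer facts (`LineInv.noSol3Chk_sound`).
* TPP forms: `no_law_cube_446_card289_of_killers`, `no_law_cube_four_four_card289_of_killers` (dihedral-like `G` over `A`, any `c₀`).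
-/

namespace Summit.MatrixMultiplication.OmegaCensus

open Finset ZpZpDomino Z17Frame446

section Core

variable {A : Type*} [AddCommGroup A] [Fintype A] [DecidableEq A]

/-- **A cube symmetric form with `|W| = |X| = 4`, `|Y| = 6` over `|A| = 289`, `A ↠ ℤ₁₇²` solves the line identity on a killer.**
[folklore] -/
theorem exists_killer_line_of_cube_form_44_card289 (hA : Fintype.card A = 289) (Φ : A →+ ZMod 17 × ZMod 17)
    (hΦ : Function.Surjective Φ) {W X Y : Finset A} {x₀ : A} (hW : W.card = 4) (hX : X.card = 4) (hY : Y.card = 6)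
    (h₁ : Set.InjOn (fun p : A × A × A => -p.1 + p.2.1 + p.2.2) ↑(W ×ˢ X ×ˢ Y))
    (h₂ : Set.InjOn (fun p : A × A × A => p.1 - p.2.1 + p.2.2) ↑(W ×ˢ X ×ˢ Y))
    (h₃ : Set.InjOn (fun p : A × A × A => p.1 + p.2.1 - p.2.2) ↑(W ×ˢ X ×ˢ Y))
    (d₁₂ : Disjoint ((W ×ˢ X ×ˢ Y).image fun p : A × A × A => -p.1 + p.2.1 + p.2.2)
      ((W ×ˢ X ×ˢ Y).image fun p : A × A × A => p.1 - p.2.1 + p.2.2))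
    (d₁₃ : Disjoint ((W ×ˢ X ×ˢ Y).image fun p : A × A × A => -p.1 + p.2.1 + p.2.2)
      ((W ×ˢ X ×ˢ Y).image fun p : A × A × A => p.1 + p.2.1 - p.2.2))
    (d₂₃ : Disjoint ((W ×ˢ X ×ˢ Y).image fun p : A × A × A => p.1 - p.2.1 + p.2.2)
      ((W ×ˢ X ×ˢ Y).image fun p : A × A × A => p.1 + p.2.1 - p.2.2))
    (hcover : ((W ×ˢ X ×ˢ Y).image fun p : A × A × A => -p.1 + p.2.1 + p.2.2) ∪
      ((W ×ˢ X ×ˢ Y).image fun p : A × A × A => p.1 - p.2.1 + p.2.2) ∪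
      ((W ×ˢ X ×ˢ Y).image fun p : A × A × A => p.1 + p.2.1 - p.2.2) = univ.erase x₀) :
    ∃ k, k < 4 ∧ ∃ Fl : List ℕ, Fl ∈ ZpZpDomino.compsLit 17 4 ∧ ∃ (G : ZMod 17 → ℕ) (s : ZMod 17), (∀ u, G u ≤ 6) ∧
      ∀ τ : ZMod 17, (∑ u : ZMod 17, lineMat3 (vecFn ((([[0,0,0,0,0,0,0,0,0,0,0,0,0,0,0,2,2], [0,0,0,0,0,0,0,0,0,0,0,0,0,0,1,1,2], [0,0,0,0,0,0,0,0,0,0,0,0,0,1,0,1,2], [0,0,0,0,0,0,0,0,0,0,0,0,1,1,0,0,2]] : List (List ℕ))).getD k [])) (vecFn Fl) τ u * G u) +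
        (if s = τ then 1 else 0) = 17 := by
  classical
  -- four distinct points `w₀, w₁, w₂, w₃`
  have hWne : W.Nonempty := by rw [← card_pos, hW]; norm_num
  obtain ⟨w₀, hw₀⟩ := hWne
  have hW3 : (W.erase w₀).card = 3 := by rw [card_erase_of_mem hw₀, hW]
  obtain ⟨w₁, w₂, w₃, h12, h13, h23, hWe⟩ := card_eq_three.1 hW3
  have hm : ∀ x, x ∈ W.erase w₀ ↔ x = w₁ ∨ x = w₂ ∨ x = w₃ := fun x => by rw [hWe]; simp
  have h01 : w₀ ≠ w₁ := fun e => by have := (hm w₁).2 (Or.inl rfl); rw [← e] at this; simp at this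
  have h02 : w₀ ≠ w₂ := fun e => by have := (hm w₂).2 (Or.inr (Or.inl rfl)); rw [← e] at this; simp at this
  have h03 : w₀ ≠ w₃ := fun e => by have := (hm w₃).2 (Or.inr (Or.inr rfl)); rw [← e] at this; simp at this
  have hWeq : W = {w₀, w₁, w₂, w₃} := by rw [← insert_erase hw₀, hWe]
  -- translate by `−w₀`
  obtain ⟨t₁, t₂, t₃, e₁₂, e₁₃, e₂₃, tcov, cW, cX, cY⟩ :=
    cube_symmetric_form_translate h₁ h₂ h₃ d₁₂ d₁₃ d₂₃ hcover (-w₀)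
  set W' := W.image (· + -w₀) with hW'
  set X' := X.image (· + -w₀) with hX'
  set Y' := Y.image (· + -w₀) with hY'
  set u₁ := w₁ - w₀ with hu₁
  set u₂ := w₂ - w₀ with hu₂
  set u₃ := w₃ - w₀ with hu₃
  have hWt : W' = {0, u₁, u₂, u₃} := by
    rw [hW', hWeq, image_insert, image_insert, image_insert, image_singleton, add_neg_cancel, hu₁, hu₂, hu₃,
      sub_eq_add_neg, sub_eq_add_neg, sub_eq_add_neg]
  have h10 : u₁ ≠ 0 := sub_ne_zero.2 (Ne.symm h01)
  have h20 : u₂ ≠ 0 := sub_ne_zero.2 (Ne.symm h02)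
  have h30 : u₃ ≠ 0 := sub_ne_zero.2 (Ne.symm h03)
  have h12' : u₁ ≠ u₂ := fun e => h12 (sub_left_injective e)
  have h13' : u₁ ≠ u₃ := fun e => h13 (sub_left_injective e)
  have h23' : u₂ ≠ u₃ := fun e => h23 (sub_left_injective e)
  have hXc : X'.card = 4 := by rw [cX, hX]
  have hYc : Y'.card = 6 := by rw [cY, hY]
  by_cases hD12 : (Φ u₁).1 * (Φ u₂).2 - (Φ u₁).2 * (Φ u₂).1 = 0
  · by_cases hD13 : (Φ u₁).1 * (Φ u₃).2 - (Φ u₁).2 * (Φ u₃).1 = 0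
    · by_cases hD23 : (Φ u₂).1 * (Φ u₃).2 - (Φ u₂).2 * (Φ u₃).1 = 0
      · -- all images on one line through `0`: `W'` in a proper subgroup
        exfalso
        obtain ⟨ab, hab, hau, hav, haw⟩ := exists_form_of_dets_eq_zero (Φ u₁) (Φ u₂) (Φ u₃) hD12 hD13 hD23
        haveI : Fact (Nat.Prime 17) := ⟨by norm_num⟩
        have habne : ab.1 ≠ 0 ∨ ab.2 ≠ 0 := by
          by_contra hc
          push Not at hc
          exact hab (Prod.ext hc.1 hc.2)
        set ψ : A →+ ZMod 17 := (lmap ab.1 ab.2).comp Φ with hψ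
        have hψs : Function.Surjective ψ := (lmap_surjective_of_ne habne).comp hΦ
        have hH : ψ.ker ≠ ⊤ := by
          intro htop
          obtain ⟨x, hx⟩ := hψs 1
          have hmem : x ∈ ψ.ker := by rw [htop]; exact AddSubgroup.mem_top x
          rw [AddMonoidHom.mem_ker] at hmem
          exact absurd (hx.symm.trans hmem) one_ne_zero
        have hcard := card_eq_one_of_subset_coset t₁ t₂ t₃ e₁₂ e₁₃ e₂₃ tcov ψ.ker hH 0 (fun w hw => by
          rw [sub_zero, AddMonoidHom.mem_ker]
          rw [hWt] at hw
          simp only [mem_insert, mem_singleton] at hw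
          rcases hw with rfl | rfl | rfl | rfl
          · exact map_zero ψ
          · show lmap ab.1 ab.2 (Φ u₁) = 0
            rw [lmap_apply]; exact hau
          · show lmap ab.1 ab.2 (Φ u₂) = 0
            rw [lmap_apply]; exact hav
          · show lmap ab.1 ab.2 (Φ u₃) = 0
            rw [lmap_apply]; exact haw)
        rw [cW, hW] at hcard
        omega
      · -- frame `(u₂, u₃)`, fourth point `u₁`
        have hWt' : W' = {0, u₂, u₃, u₁} := by
          rw [hWt]; ext x; simp only [mem_insert, mem_singleton]; tauto
        exact exists_killer_line_core hA Φ hΦ hWt' h20 h30 h10 h23' h12'.symm h13'.symm hD23 hXc hYc t₁ t₂ t₃ e₁₂ e₁₃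
          e₂₃ tcov
    · -- frame `(u₁, u₃)`, fourth point `u₂`
      have hWt' : W' = {0, u₁, u₃, u₂} := by
        rw [hWt]; ext x; simp only [mem_insert, mem_singleton]; tauto
      exact exists_killer_line_core hA Φ hΦ hWt' h10 h30 h20 h13' h12' h23'.symm hD13 hXc hYc t₁ t₂ t₃ e₁₂ e₁₃ e₂₃ tcov
  · exact exists_killer_line_core hA Φ hΦ hWt h10 h20 h30 h12' h13' h23' hD12 hXc hYc t₁ t₂ t₃ e₁₂ e₁₃ e₂₃ tcov

/-- **No cube symmetric form with `|W| = |X| = 4`, `|Y| = 6` over `|A| = 289`, `A ↠ ℤ₁₇²` — given the killer facts.** [folklore] -/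
theorem no_cube_form_44_card289_of_killers
    (hkill : ∀ k, k < 4 → ∀ F ∈ ZpZpDomino.compsLit 17 4,
      (LineInv.noSol3Chk 17 103 64 17 6 ((([[0,0,0,0,0,0,0,0,0,0,0,0,0,0,0,2,2], [0,0,0,0,0,0,0,0,0,0,0,0,0,0,1,1,2], [0,0,0,0,0,0,0,0,0,0,0,0,0,1,0,1,2], [0,0,0,0,0,0,0,0,0,0,0,0,1,1,0,0,2]] : List (List ℕ))).getD k []) F ||
        LineInv.noSol3Chk 17 137 119 17 6 ((([[0,0,0,0,0,0,0,0,0,0,0,0,0,0,0,2,2], [0,0,0,0,0,0,0,0,0,0,0,0,0,0,1,1,2], [0,0,0,0,0,0,0,0,0,0,0,0,0,1,0,1,2], [0,0,0,0,0,0,0,0,0,0,0,0,1,1,0,0,2]] : List (List ℕ))).getD k []) F) = true)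
    (hA : Fintype.card A = 289) (Φ : A →+ ZMod 17 × ZMod 17)
    (hΦ : Function.Surjective Φ) {W X Y : Finset A} {x₀ : A} (hW : W.card = 4) (hX : X.card = 4) (hY : Y.card = 6)
    (h₁ : Set.InjOn (fun p : A × A × A => -p.1 + p.2.1 + p.2.2) ↑(W ×ˢ X ×ˢ Y))
    (h₂ : Set.InjOn (fun p : A × A × A => p.1 - p.2.1 + p.2.2) ↑(W ×ˢ X ×ˢ Y))
    (h₃ : Set.InjOn (fun p : A × A × A => p.1 + p.2.1 - p.2.2) ↑(W ×ˢ X ×ˢ Y))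
    (d₁₂ : Disjoint ((W ×ˢ X ×ˢ Y).image fun p : A × A × A => -p.1 + p.2.1 + p.2.2)
      ((W ×ˢ X ×ˢ Y).image fun p : A × A × A => p.1 - p.2.1 + p.2.2))
    (d₁₃ : Disjoint ((W ×ˢ X ×ˢ Y).image fun p : A × A × A => -p.1 + p.2.1 + p.2.2)
      ((W ×ˢ X ×ˢ Y).image fun p : A × A × A => p.1 + p.2.1 - p.2.2))
    (d₂₃ : Disjoint ((W ×ˢ X ×ˢ Y).image fun p : A × A × A => p.1 - p.2.1 + p.2.2)
      ((W ×ˢ X ×ˢ Y).image fun p : A × A × A => p.1 + p.2.1 - p.2.2))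
    (hcover : ((W ×ˢ X ×ˢ Y).image fun p : A × A × A => -p.1 + p.2.1 + p.2.2) ∪
      ((W ×ˢ X ×ˢ Y).image fun p : A × A × A => p.1 - p.2.1 + p.2.2) ∪
      ((W ×ˢ X ×ˢ Y).image fun p : A × A × A => p.1 + p.2.1 - p.2.2) = univ.erase x₀) : False := by
  obtain ⟨k, hk, Fl, hFl, G, s, hG, hid⟩ :=
    exists_killer_line_of_cube_form_44_card289 hA Φ hΦ hW hX hY h₁ h₂ h₃ d₁₂ d₁₃ d₂₃ hcover
  have h := hkill k hk Fl hFl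
  rw [Bool.or_eq_true] at h
  rcases h with h | h
  · exact LineInv.noSol3Chk_sound h G s hG hid
  · exact LineInv.noSol3Chk_sound h G s hG hid

end Core

/-! ## The TPP statements (modulo the killer facts) -/

section DihedralLike

variable {A : Type} [AddCommGroup A] [DecidableEq A] [Fintype A] {G : Type} [Group G] [DecidableEq G]
  {ρ τ : A → G} {c₀ : A} {S T U : Finset G}

open Literature.Combinatorics.Additive

/-- **No `(4,4 | 4,4 | 6,6)` law triple over `|A| = 289`, `A ↠ ℤ₁₇²`** (dihedral-like `G`, any `c₀`) — given the killer facts.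
[folklore] -/
theorem no_law_cube_446_card289_of_killers
    (hkill : ∀ k, k < 4 → ∀ F ∈ ZpZpDomino.compsLit 17 4,
      (LineInv.noSol3Chk 17 103 64 17 6 ((([[0,0,0,0,0,0,0,0,0,0,0,0,0,0,0,2,2], [0,0,0,0,0,0,0,0,0,0,0,0,0,0,1,1,2], [0,0,0,0,0,0,0,0,0,0,0,0,0,1,0,1,2], [0,0,0,0,0,0,0,0,0,0,0,0,1,1,0,0,2]] : List (List ℕ))).getD k []) F ||
        LineInv.noSol3Chk 17 137 119 17 6 ((([[0,0,0,0,0,0,0,0,0,0,0,0,0,0,0,2,2], [0,0,0,0,0,0,0,0,0,0,0,0,0,0,1,1,2], [0,0,0,0,0,0,0,0,0,0,0,0,0,1,0,1,2], [0,0,0,0,0,0,0,0,0,0,0,0,1,1,0,0,2]] : List (List ℕ))).getD k []) F) = true)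
    (hA : Fintype.card A = 289)
    (hρρ : ∀ a b, ρ a * ρ b = ρ (a + b)) (hρτ : ∀ a b, ρ a * τ b = τ (b - a))
    (hτρ : ∀ a b, τ a * ρ b = τ (a + b)) (hττ : ∀ a b, τ a * τ b = ρ (c₀ + b - a))
    (hρ : Function.Injective ρ) (hτ : Function.Injective τ) (hne : ∀ a b, ρ a ≠ τ b)
    (hsurj : ∀ g, (∃ a, ρ a = g) ∨ (∃ a, τ a = g))
    (Φ : A →+ ZMod 17 × ZMod 17) (hΦ : Function.Surjective Φ)
    (h : TripleProductProperty S T U)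
    (hS₀ : (univ.filter fun a : A => ρ a ∈ S).card = 4) (hS₁ : (univ.filter fun a : A => τ a ∈ S).card = 4)
    (hT₀ : (univ.filter fun a : A => ρ a ∈ T).card = 4) (hT₁ : (univ.filter fun a : A => τ a ∈ T).card = 4)
    (hU : (univ.filter fun a : A => ρ a ∈ U).card = (univ.filter fun a : A => τ a ∈ U).card)
    (hV : 3 * (S.card * T.card * U.card) + 8 = 8 * Fintype.card A) : False := by
  classical
  have hhalf : ∀ c : A, ∃ a : A, a + a = c := exists_add_self_eq_of_card_odd (by rw [hA]; decide)
  obtain ⟨W, X, Y, x₀, hWc, hXc, hYc, i₁, i₂, i₃, d₁₂, d₁₃, d₂₃, hcover⟩ :=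
    cube_symmetric_form_of_law hρρ hρτ hτρ hττ hρ hτ hne hsurj hhalf h (by rw [hS₀, hS₁]) (by rw [hT₀, hT₁]) hU hV
  rw [hS₀] at hWc
  rw [hT₀] at hXc
  -- `|Y| = 6` from the law: `|S| = |T| = 8`, `|U| = 2|Y|`
  have cS := card_eq_parts' hρ hτ hne hsurj S
  have cT := card_eq_parts' hρ hτ hne hsurj T
  have cU := card_eq_parts' hρ hτ hne hsurj U
  rw [hS₀, hS₁] at cS
  rw [hT₀, hT₁] at cT
  rw [← hU, ← hYc] at cU
  have hY6 : Y.card = 6 := by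
    rw [cS, cT, cU, hA] at hV
    omega
  exact no_cube_form_44_card289_of_killers hkill hA Φ hΦ hWc hXc hY6 i₁ i₂ i₃ d₁₂ d₁₃ d₂₃ hcover

/-- **Cell form `(4,4,·)@289`**: balanced coset parts with two parts `4` in any two of `S, T, U` ⇒ `3|S||T||U| + 8 ≠ 8|A|` over
`|A| = 289`, `A ↠ ℤ₁₇²` — given the killer facts. [folklore] -/
theorem no_law_cube_four_four_card289_of_killers
    (hkill : ∀ k, k < 4 → ∀ F ∈ ZpZpDomino.compsLit 17 4,
      (LineInv.noSol3Chk 17 103 64 17 6 ((([[0,0,0,0,0,0,0,0,0,0,0,0,0,0,0,2,2], [0,0,0,0,0,0,0,0,0,0,0,0,0,0,1,1,2], [0,0,0,0,0,0,0,0,0,0,0,0,0,1,0,1,2], [0,0,0,0,0,0,0,0,0,0,0,0,1,1,0,0,2]] : List (List ℕ))).getD k []) F ||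
        LineInv.noSol3Chk 17 137 119 17 6 ((([[0,0,0,0,0,0,0,0,0,0,0,0,0,0,0,2,2], [0,0,0,0,0,0,0,0,0,0,0,0,0,0,1,1,2], [0,0,0,0,0,0,0,0,0,0,0,0,0,1,0,1,2], [0,0,0,0,0,0,0,0,0,0,0,0,1,1,0,0,2]] : List (List ℕ))).getD k []) F) = true)
    (hA : Fintype.card A = 289)
    (hρρ : ∀ a b, ρ a * ρ b = ρ (a + b)) (hρτ : ∀ a b, ρ a * τ b = τ (b - a))
    (hτρ : ∀ a b, τ a * ρ b = τ (a + b)) (hττ : ∀ a b, τ a * τ b = ρ (c₀ + b - a))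
    (hρ : Function.Injective ρ) (hτ : Function.Injective τ) (hne : ∀ a b, ρ a ≠ τ b)
    (hsurj : ∀ g, (∃ a, ρ a = g) ∨ (∃ a, τ a = g))
    (Φ : A →+ ZMod 17 × ZMod 17) (hΦ : Function.Surjective Φ)
    (h : TripleProductProperty S T U)
    (hS : (univ.filter fun a : A => ρ a ∈ S).card = (univ.filter fun a : A => τ a ∈ S).card)
    (hT : (univ.filter fun a : A => ρ a ∈ T).card = (univ.filter fun a : A => τ a ∈ T).card)
    (hU : (univ.filter fun a : A => ρ a ∈ U).card = (univ.filter fun a : A => τ a ∈ U).card)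
    (h44 : ((univ.filter fun a : A => ρ a ∈ S).card = 4 ∧ (univ.filter fun a : A => ρ a ∈ T).card = 4) ∨
      ((univ.filter fun a : A => ρ a ∈ T).card = 4 ∧ (univ.filter fun a : A => ρ a ∈ U).card = 4) ∨
      ((univ.filter fun a : A => ρ a ∈ U).card = 4 ∧ (univ.filter fun a : A => ρ a ∈ S).card = 4)) :
    3 * (S.card * T.card * U.card) + 8 ≠ 8 * Fintype.card A := by
  refine no_law_cube_two_parts_of_ordered 4 4 (fun h' hS₀ hS₁ hT₀ hT₁ hU' hV' =>
    no_law_cube_446_card289_of_killers hkill hA hρρ hρτ hτρ hττ hρ hτ hne hsurj Φ hΦ h' hS₀ hS₁ hT₀ hT₁ hU' hV') h hS hT hU ?_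
  rcases h44 with h44 | h44 | h44
  · exact Or.inl h44
  · exact Or.inr (Or.inl h44)
  · exact Or.inr (Or.inr (Or.inl h44))

end DihedralLike

end Summit.MatrixMultiplication.OmegaCensus
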